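import Mathlib.GroupTheory.SpecificGroups.Dihedral
import Mathlib.GroupTheory.Index
import Mathlib.GroupTheory.OrderOfElement
import HarnessLib

/-!
# Recognising a dihedral group

Topic `Literature/NumberTheory/GaloisRepresentations` (companion of `ProjectiveType.lean`, whose
`IsDihedralType ρ` asks for an isomorphism of the projective image with Mathlib's
`DihedralGroup m`).  Pure group theory, theorems only, no named fact:

* `nonempty_mulEquiv_dihedralGroup` — **a finite group `Γ` containing an element `a` and an
  element `s ∉ ⟨a⟩` with `s² = 1`, `s a s⁻¹ = a⁻¹` and `Γ = ⟨a⟩ ∪ s⟨a⟩ is isomorphic to the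
  dihedral group `D_{ord a}`** (`DihedralGroup (orderOf a)`, of order `2 · ord a`); the
  isomorphism sends `r i ↦ a^i`, `sr i ↦ s a^i`.

Mathlib (this pin) has `DihedralGroup n` with its multiplication table (`r_mul_r`, `r_mul_sr`,
`sr_mul_r`, `sr_mul_sr`), cardinality `DihedralGroup.nat_card` and element orders, but no
recognition theorem / universal property for it (grep `DihedralGroup` in `Mathlib/GroupTheory`:
only `SpecificGroups/Dihedral.lean`, `SpecificGroups/KleinFour.lean`, `Exponent`); this file
supplies the one used for projective images of monomial two-dimensional representations
(`SolvableIrreducibleCharTwo.lean`).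

## References

* Standard; e.g. D. S. Dummit, R. M. Foote, *Abstract Algebra*, 3rd ed., §1.2 (presentation
  `⟨r, s | rⁿ = s² = 1, rs = sr⁻¹⟩`, every element uniquely `rⁱ` or `srⁱ`). [folklore]
-/

namespace Literature.NumberTheory.GaloisRepresentations

namespace DihedralRecognition

variable {Γ : Type*} [Group Γ]

/-! ### Exponent arithmetic modulo the order of `a` -/

/-- `a^{(i+j) mod n} = a^{i mod n} a^{j mod n}` for `n = ord a` (exponents read through
`ZMod.val`). [folklore] -/
theorem pow_val_add [Finite Γ] (a : Γ) (i j : ZMod (orderOf a)) :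
    a ^ (i + j).val = a ^ i.val * a ^ j.val := by
  haveI : NeZero (orderOf a) := ⟨(orderOf_pos a).ne'⟩
  rw [← pow_add, pow_eq_pow_iff_modEq, ZMod.val_add]
  exact Nat.mod_modEq _ _

/-- `a^{(-i) mod n} = (a^{i mod n})⁻¹` for `n = ord a`. [folklore] -/
theorem pow_val_neg [Finite Γ] (a : Γ) (i : ZMod (orderOf a)) :
    a ^ (-i).val = (a ^ i.val)⁻¹ := by
  have h := pow_val_add a i (-i)
  rw [add_neg_cancel, ZMod.val_zero, pow_zero] at h
  exact eq_inv_of_mul_eq_one_right h.symm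

/-- `a^{(j-i) mod n} = a^{j mod n} (a^{i mod n})⁻¹` for `n = ord a`. [folklore] -/
theorem pow_val_sub [Finite Γ] (a : Γ) (i j : ZMod (orderOf a)) :
    a ^ (j - i).val = a ^ j.val * (a ^ i.val)⁻¹ := by
  rw [sub_eq_add_neg, pow_val_add, pow_val_neg]

/-- `a^{(m mod n)} = a^m` for `n = ord a` and a natural number `m` cast into `ZMod n`.
[folklore] -/
theorem pow_val_natCast (a : Γ) (m : ℕ) : a ^ ((m : ZMod (orderOf a)).val) = a ^ m := by
  rw [ZMod.val_natCast, pow_mod_orderOf]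

/-- If `s a s⁻¹ = a⁻¹` then `s a^m s⁻¹ = (a^m)⁻¹`. [folklore] -/
theorem conj_pow_eq_inv {a s : Γ} (hsa : s * a * s⁻¹ = a⁻¹) (m : ℕ) :
    s * a ^ m * s⁻¹ = (a ^ m)⁻¹ := by
  have h1 : MulAut.conj s a = a⁻¹ := by simpa [MulAut.conj_apply] using hsa
  calc s * a ^ m * s⁻¹ = MulAut.conj s (a ^ m) := by simp [MulAut.conj_apply]
    _ = (MulAut.conj s a) ^ m := map_pow _ _ _
    _ = (a ^ m)⁻¹ := by rw [h1, inv_pow]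

/-- If `s a s⁻¹ = a⁻¹` then `a^m s = s (a^m)⁻¹`. [folklore] -/
theorem pow_mul_eq_mul_inv {a s : Γ} (hsa : s * a * s⁻¹ = a⁻¹) (m : ℕ) :
    a ^ m * s = s * (a ^ m)⁻¹ := by
  have h := congrArg (·⁻¹) (conj_pow_eq_inv hsa m)
  simp only [mul_inv_rev, inv_inv] at h
  calc a ^ m * s = s * ((a ^ m)⁻¹ * s⁻¹) * s := by rw [h]
    _ = s * (a ^ m)⁻¹ := by group

/-- If `s ∉ ⟨a⟩` and `Γ = ⟨a⟩ ∪ s⟨a⟩`, then `⟨a⟩` has index `2` and `|Γ| = 2 · ord a`.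
[folklore] -/
theorem card_eq_two_mul_orderOf [Finite Γ] {a s : Γ} (hs : s ∉ Subgroup.zpowers a)
    (hcover : ∀ g : Γ, g ∈ Subgroup.zpowers a ∨ s⁻¹ * g ∈ Subgroup.zpowers a) :
    Nat.card Γ = 2 * orderOf a := by
  have hindex : (Subgroup.zpowers a).index = 2 := by
    rw [Subgroup.index_eq_two_iff_exists_notMem_and']
    refine ⟨s⁻¹, fun h => hs ?_, fun b => (hcover b).symm⟩
    simpa using Subgroup.inv_mem _ h
  have h := (Subgroup.zpowers a).index_mul_card
  rw [hindex, Nat.card_zpowers] at h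
  exact h.symm

end DihedralRecognition

open DihedralRecognition in
/-- **Recognition of dihedral groups.** Let `Γ` be a finite group, `a s ∈ Γ` with `s ∉ ⟨a⟩`,
`s² = 1`, `s a s⁻¹ = a⁻¹`, and suppose every element of `Γ` lies in `⟨a⟩` or in `s⟨a⟩`.  Then
`Γ ≅ D_{ord a}` (Mathlib `DihedralGroup (orderOf a)`, of order `2 · ord a`), by `r i ↦ a^i`,
`sr i ↦ s a^i` (a homomorphism by the relations, onto by the covering hypothesis, hence
bijective since `⟨a⟩` has index `2`). [folklore] -/
theorem nonempty_mulEquiv_dihedralGroup {Γ : Type*} [Group Γ] [Finite Γ] {a s : Γ}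
    (hs : s ∉ Subgroup.zpowers a) (hs2 : s * s = 1) (hsa : s * a * s⁻¹ = a⁻¹)
    (hcover : ∀ g : Γ, g ∈ Subgroup.zpowers a ∨ s⁻¹ * g ∈ Subgroup.zpowers a) :
    Nonempty (Γ ≃* DihedralGroup (orderOf a)) := by
  haveI : NeZero (orderOf a) := ⟨(orderOf_pos a).ne'⟩
  have hcomm : ∀ i j : ZMod (orderOf a), a ^ j.val * (a ^ i.val)⁻¹ = (a ^ i.val)⁻¹ * a ^ j.val :=
    fun i j => ((Commute.pow_pow_self a j.val i.val).inv_right).eq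
  -- the candidate isomorphism `D_{ord a} → Γ`: `r i ↦ a^i`, `sr i ↦ s a^i`
  let f : DihedralGroup (orderOf a) → Γ := fun x =>
    match x with
    | .r i => a ^ i.val
    | .sr i => s * a ^ i.val
  have hf_r : ∀ i, f (.r i) = a ^ i.val := fun i => rfl
  have hf_sr : ∀ i, f (.sr i) = s * a ^ i.val := fun i => rfl
  -- it is multiplicative by the relations
  have hmul : ∀ x y, f (x * y) = f x * f y := by
    rintro (i | i) (j | j)
    · rw [DihedralGroup.r_mul_r, hf_r, hf_r, hf_r, pow_val_add]
    · rw [DihedralGroup.r_mul_sr, hf_r, hf_sr, hf_sr, pow_val_sub,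
        ← mul_assoc (a ^ i.val) s (a ^ j.val), pow_mul_eq_mul_inv hsa, hcomm, mul_assoc]
    · rw [DihedralGroup.sr_mul_r, hf_sr, hf_sr, hf_r, pow_val_add, mul_assoc]
    · rw [DihedralGroup.sr_mul_sr, hf_sr, hf_sr, hf_r, pow_val_sub]
      calc a ^ j.val * (a ^ i.val)⁻¹ = (s * s) * ((a ^ i.val)⁻¹ * a ^ j.val) := by
            rw [hs2, one_mul, hcomm]
        _ = s * (a ^ i.val * s) * a ^ j.val := by rw [pow_mul_eq_mul_inv hsa]; group
        _ = s * a ^ i.val * (s * a ^ j.val) := by group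
  let F : DihedralGroup (orderOf a) →* Γ := MonoidHom.mk' f hmul
  have hF : ∀ x, F x = f x := fun x => rfl
  -- onto, by the covering hypothesis
  have hsurj : Function.Surjective F := by
    intro g
    rcases hcover g with hg | hg
    · obtain ⟨m, hm⟩ := (Submonoid.mem_powers_iff _ _).mp ((mem_powers_iff_mem_zpowers).mpr hg)
      exact ⟨.r m, by rw [hF, hf_r, pow_val_natCast, hm]⟩
    · obtain ⟨m, hm⟩ := (Submonoid.mem_powers_iff _ _).mp ((mem_powers_iff_mem_zpowers).mpr hg)
      refine ⟨.sr m, ?_⟩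
      rw [hF, hf_sr, pow_val_natCast, hm]
      group
  -- hence bijective, both sides having `2 · ord a` elements
  have hbij : Function.Bijective F := by
    rw [Nat.bijective_iff_surjective_and_card]
    exact ⟨hsurj, by rw [DihedralGroup.nat_card, card_eq_two_mul_orderOf hs hcover]⟩
  exact ⟨(MulEquiv.ofBijective F hbij).symm⟩

end Literature.NumberTheory.GaloisRepresentations
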